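import Summits.QuantumFields.YangMills.Theorems.SmallCircleAnchorAnchorGapStubDebyeScreening15

/-!
# Crux `AnchorGap` (stmt-QuantumFields-11141), line `registered` — smooth zero-mode fixing of the cell ensemble (under stub X₀)

The `ε = 0` cell ensemble of stub X₀ integrates `Λ'`-periodic functionals (`Λ' = Σ_j ℤ b_j`, acting
by constant shifts of the field) over the sharp fundamental cell `S = {θ̄(φ) ∈ b·[0,1)^k}` of the
zero mode `θ̄(φ) = V⁻¹ Σ_x φ(x)`.  A sharp, non-local indicator is incompatible with an expansion
generated by field derivatives; it can be traded for ANY partition of unity of the zero mode: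

* `integral_zeroMode_partition` — for a `Λ'`-periodic measurable `I` with `1_S I` integrable and a
  measurable `ρ ≥ 0` on `ℝ^k` with `Σ_{n ∈ ℤ^k} ρ(θ + w_n) = 1` (`w_n = Σ_j n_j b_j`),
  `∫ ρ(θ̄(φ)) I(φ) dφ = ∫ 1_S I` (unfolding over the fundamental domain `S` of the `ℤ^k`-action,
  `IsAddFundamentalDomain.integral_eq_tsum''`, and resummation of `ρ` along each orbit);
* `cellExpect_eq_partitionExpect` — hence the cell expectation of X₀ equals
  `∫ ρ(θ̄) H weight₀ / ∫ ρ(θ̄) weight₀` for every such `ρ`, every bounded measurable `Λ'`-periodic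
  `H` and charges dual to `b` (the `ε = 0` weight is `Λ'`-periodic, `weight_add_dual`): the
  expansion may use a smooth compactly supported zero-mode cutoff.
-/

set_option autoImplicit false

noncomputable section

namespace Summit.QuantumFields.YangMills.Theorems.AnchorGap

open MeasureTheory Finset
open Literature.Probability.LatticeModels

/-- **Unfolding the cell constraint against a partition of unity of the zero mode.** Let `b` be a
basis of `ℝ^k`, `w_n = Σ_j n_j b_j` (`n ∈ ℤ^k`), `S` the set of configurations whose zero-mode
average lies in the half-open cell `b·[0,1)^k`, `I` a measurable functional invariant under the
constant shifts `φ ↦ φ + w_n` with `1_S I` integrable, and `ρ ≥ 0` measurable on `ℝ^k` with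
`Σ_n ρ(θ + w_n) = 1` for every `θ`.  Then `∫ ρ(θ̄(φ)) I(φ) dφ = ∫ 1_S I dφ`. [folklore] -/
theorem integral_zeroMode_partition :
    ∀ (d N k : ℕ) [NeZero N] (b : Fin k → Fin k → ℝ), LinearIndependent ℝ b → ∀ (I : LatticeSineGordon.Config d N k → ℝ), Measurable I → (∀ (φ : LatticeSineGordon.Config d N k) (n : Fin k → ℤ), I (fun p => φ p + ∑ j : Fin k, (n j : ℝ) * b j p.2) = I φ) → Integrable ({φ : LatticeSineGordon.Config d N k | ∃ t : Fin k → ℝ, (∀ j : Fin k, 0 ≤ t j ∧ t j < 1) ∧ ∀ a : Fin k, (Fintype.card (TorusSite d N) : ℝ)⁻¹ * ∑ x : TorusSite d N, φ (x, a) = ∑ j : Fin k, t j * b j a}.indicator I) → ∀ (ρ : (Fin k → ℝ) → ℝ), Measurable ρ → (∀ θ : Fin k → ℝ, 0 ≤ ρ θ) → (∀ θ : Fin k → ℝ, Summable (fun n : Fin k → ℤ => ρ (θ + fun c => ∑ j : Fin k, (n j : ℝ) * b j c)) ∧ ∑' n : Fin k → ℤ, ρ (θ + fun c => ∑ j : Fin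 k, (n j : ℝ) * b j c) = 1) → ∫ φ : LatticeSineGordon.Config d N k, ρ (fun c => (Fintype.card (TorusSite d N) : ℝ)⁻¹ * ∑ x : TorusSite d N, φ (x, c)) * I φ = ∫ φ : LatticeSineGordon.Config d N k, {φ : LatticeSineGordon.Config d N k | ∃ t : Fin k → ℝ, (∀ j : Fin k, 0 ≤ t j ∧ t j < 1) ∧ ∀ a : Fin k, (Fintype.card (TorusSite d N) : ℝ)⁻¹ * ∑ x : TorusSite d N, φ (x, a) = ∑ j : Fin k, t j * b j a}.indicator I φ := by
  intro d N k _ b hb I hIm hIper hIS ρ hρm hρ0 hρ1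
  classical
  -- notation: volume `V`, lattice vectors `w n`, zero mode `θb`
  set V : ℝ := (Fintype.card (TorusSite d N) : ℝ) with hV
  have hVpos : 0 < V := by
    rw [hV]; exact_mod_cast Fintype.card_pos
  have hVne : V ≠ 0 := hVpos.ne'
  set w : (Fin k → ℤ) → Fin k → ℝ := fun n c => ∑ j, (n j : ℝ) * b j c with hw
  set θb : LatticeSineGordon.Config d N k → Fin k → ℝ := fun φ c => V⁻¹ * ∑ x, φ (x, c) with hθb
  set S : Set (LatticeSineGordon.Config d N k) := {φ | ∃ t : Fin k → ℝ, (∀ j : Fin k, 0 ≤ t j ∧ t j < 1) ∧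
    ∀ a : Fin k, V⁻¹ * ∑ x : TorusSite d N, φ (x, a) = ∑ j : Fin k, t j * b j a} with hS
  -- the basis and its fundamental cell
  let B := basisOfPiSpaceOfLinearIndependent hb
  have hB : ⇑B = b := coe_basisOfPiSpaceOfLinearIndependent hb
  let L : Submodule ℤ (Fin k → ℝ) := Submodule.span ℤ (Set.range B)
  let e : (Fin k → ℤ) ≃ L := (B.restrictScalars ℤ).equivFun.symm.toEquiv
  have he : ∀ n : Fin k → ℤ, ((e n : L) : Fin k → ℝ) = w n := by
    intro n
    simp only [e, LinearEquiv.coe_toEquiv, Module.Basis.equivFun_symm_apply, hw]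
    rw [Submodule.coe_sum]
    funext c
    simp [Module.Basis.restrictScalars_apply, ← hB, zsmul_eq_mul, Finset.sum_apply]
  have hD : ∀ θ : Fin k → ℝ, (∃ t : Fin k → ℝ, (∀ j : Fin k, 0 ≤ t j ∧ t j < 1) ∧
      ∀ a : Fin k, θ a = ∑ j : Fin k, t j * b j a) ↔ θ ∈ ZSpan.fundamentalDomain B := by
    intro θ
    rw [ZSpan.mem_fundamentalDomain]
    constructor
    · rintro ⟨t, ht, hθt⟩ i
      have hθ : θ = ∑ j, t j • B j := by
        funext a
        rw [hθt a, Finset.sum_apply]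
        simp [hB, smul_eq_mul]
      rw [hθ, Module.Basis.repr_sum_self]
      exact ⟨(ht i).1, (ht i).2⟩
    · intro h
      refine ⟨fun j => B.repr θ j, fun j => ⟨(h j).1, (h j).2⟩, fun a => ?_⟩
      conv_lhs => rw [← B.sum_repr θ]
      rw [Finset.sum_apply]
      simp [hB, smul_eq_mul]
  have hSpre : S = θb ⁻¹' ZSpan.fundamentalDomain B := by
    ext φ
    simp only [hS, Set.mem_setOf_eq, Set.mem_preimage]
    exact hD (θb φ)
  have hθb_cont : Continuous θb := by
    rw [hθb]; fun_prop
  have hSmeas : MeasurableSet S := by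
    rw [hSpre]
    exact measurableSet_preimage hθb_cont.measurable (ZSpan.fundamentalDomain_measurableSet B)
  -- the action of `ℤᵏ` on configurations by constant dual-lattice shifts
  letI act : AddAction (Fin k → ℤ) (LatticeSineGordon.Config d N k) :=
    { vadd := fun n φ => fun p => φ p + w n p.2
      zero_vadd := fun φ => by
        funext p
        show φ p + w 0 p.2 = φ p
        simp [hw]
      add_vadd := fun m n φ => by
        funext p
        show φ p + w (m + n) p.2 = (φ p + w n p.2) + w m p.2
        simp only [hw, Pi.add_apply, Int.cast_add, add_mul, sum_add_distrib]
        ring }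
  have hvadd : ∀ (n : Fin k → ℤ) (φ : LatticeSineGordon.Config d N k),
      n +ᵥ φ = fun p => φ p + w n p.2 := fun _ _ => rfl
  have hvadd' : ∀ (n : Fin k → ℤ), (fun φ : LatticeSineGordon.Config d N k => n +ᵥ φ) =
      fun φ => φ + fun p => w n p.2 := fun n => rfl
  haveI : MeasurableConstVAdd (Fin k → ℤ) (LatticeSineGordon.Config d N k) :=
    ⟨fun n => by rw [hvadd']; exact measurable_add_const _⟩
  haveI hri : (volume : Measure (LatticeSineGordon.Config d N k)).IsAddRightInvariant := by
    rw [volume_pi]; exact Measure.pi.isAddRightInvariant _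
  haveI : VAddInvariantMeasure (Fin k → ℤ) (LatticeSineGordon.Config d N k) volume :=
    ⟨fun n s _ => by rw [hvadd']; exact measure_preimage_add_right _ _ _⟩
  -- zero mode of a shifted configuration
  have hθvadd : ∀ (n : Fin k → ℤ) (φ : LatticeSineGordon.Config d N k), θb (n +ᵥ φ) = θb φ + w n := by
    intro n φ
    funext c
    simp only [hθb, hvadd, Pi.add_apply, sum_add_distrib, sum_const, card_univ, nsmul_eq_mul]
    rw [← hV]
    field_simp
  -- `S` is a fundamental domain
  have hfd : IsAddFundamentalDomain (Fin k → ℤ) S volume := by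
    refine IsAddFundamentalDomain.mk' hSmeas.nullMeasurableSet fun φ => ?_
    have hex := ZSpan.exist_unique_vadd_mem_fundamentalDomain B (θb φ)
    rw [hSpre]
    refine (e.existsUnique_congr fun n => ?_).2 hex
    rw [Set.mem_preimage, hθvadd, Submodule.vadd_def, vadd_eq_add, he, add_comm]
  -- the integrand and its shifts
  set f : LatticeSineGordon.Config d N k → ℝ := fun φ => ρ (θb φ) * I φ with hf
  have hfshift : ∀ (n : Fin k → ℤ) (φ : LatticeSineGordon.Config d N k), f (n +ᵥ φ) = ρ (θb φ + w n) * I φ := by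
    intro n φ
    rw [hf]
    simp only []
    rw [hθvadd, hvadd, hIper φ n]
  have hf_meas : Measurable f := (hρm.comp hθb_cont.measurable).mul hIm
  have hterm_meas : ∀ n : Fin k → ℤ, Measurable fun φ : LatticeSineGordon.Config d N k => ρ (θb φ + w n) * I φ :=
    fun n => (hρm.comp (hθb_cont.measurable.add_const _)).mul hIm
  -- the orbit sums of the absolute values refold to `∫_S |I|`
  have hIS' : IntegrableOn I S volume := by
    rw [← integrable_indicator_iff hSmeas]; exact hIS
  have hlin : ∀ φ : LatticeSineGordon.Config d N k,
      ∑' n : Fin k → ℤ, ‖ρ (θb φ + w n) * I φ‖ₑ = ‖I φ‖ₑ := by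
    intro φ
    obtain ⟨hsum, hone⟩ := hρ1 (θb φ)
    have h1 : ∀ n : Fin k → ℤ, ‖ρ (θb φ + w n) * I φ‖ₑ = ENNReal.ofReal (ρ (θb φ + w n)) * ‖I φ‖ₑ := by
      intro n
      rw [enorm_mul, Real.enorm_eq_ofReal (hρ0 _)]
    simp_rw [h1]
    rw [ENNReal.tsum_mul_right, ← ENNReal.ofReal_tsum_of_nonneg (fun n => hρ0 _) hsum]
    have hw' : (fun n : Fin k → ℤ => ρ (θb φ + w n)) = fun n => ρ (θb φ + fun c => ∑ j : Fin k, (n j : ℝ) * b j c) := by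
      funext n; rfl
    rw [hw', hone, ENNReal.ofReal_one, one_mul]
  have hF_sum : ∑' n : Fin k → ℤ, ∫⁻ φ in S, ‖ρ (θb φ + w n) * I φ‖ₑ ≠ ⊤ := by
    rw [← lintegral_tsum fun n => ((hterm_meas n).enorm).aemeasurable]
    simp_rw [hlin]
    exact hIS'.2.ne
  -- integrability of `f` on the whole space
  have hf_int : Integrable f := by
    refine ⟨hf_meas.aestronglyMeasurable, ?_⟩
    rw [HasFiniteIntegral, hfd.lintegral_eq_tsum'' (fun φ => ‖f φ‖ₑ)]
    simp_rw [hfshift]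
    exact lt_top_iff_ne_top.2 hF_sum
  -- unfold, resum `ρ` along each orbit, refold
  rw [hfd.integral_eq_tsum'' f hf_int]
  simp_rw [hfshift]
  rw [← integral_tsum (fun n => (hterm_meas n).aestronglyMeasurable) hF_sum]
  rw [← integral_indicator hSmeas]
  refine integral_congr_ae (Filter.Eventually.of_forall fun φ => ?_)
  by_cases hφ : φ ∈ S
  · rw [Set.indicator_of_mem hφ, Set.indicator_of_mem hφ, tsum_mul_right]
    obtain ⟨-, hone⟩ := hρ1 (θb φ)
    have hw' : (fun n : Fin k → ℤ => ρ (θb φ + w n)) = fun n => ρ (θb φ + fun c => ∑ j : Fin k, (n j : ℝ) * b j c) := by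
      funext n; rfl
    rw [hw', hone, one_mul]
  · rw [Set.indicator_of_notMem hφ, Set.indicator_of_notMem hφ]

/-- **The cell expectation with a smooth zero-mode cutoff.** For charges `α` dual to the basis
`b` (`α_r·b_j ∈ 2πℤ`), `g ≠ 0`, a bounded measurable `H` invariant under the constant shifts
`φ ↦ φ + Σ_j n_j b_j`, and any measurable `ρ ≥ 0` on `ℝ^k` with `Σ_n ρ(θ + w_n) = 1`, the `ε = 0` cell
expectation of stub X₀ equals the `ρ`-weighted one:
`∫ 1_S H weight₀ / ∫ 1_S weight₀ = ∫ ρ(θ̄) H weight₀ / ∫ ρ(θ̄) weight₀`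
(`integral_zeroMode_partition` for `H·weight₀` and for `weight₀`, which are shift invariant by
`weight_add_dual` at `ε = 0`).  So the non-local sharp cell indicator may be replaced by a smooth
zero-mode factor `ρ(V⁻¹Σ_x φ_x)` before expanding. [folklore] -/
theorem cellExpect_eq_partitionExpect :
    ∀ (d N k : ℕ) [NeZero N] (ι : Type) [Fintype ι] (α : ι → Fin k → ℝ) (b : Fin k → Fin k → ℝ), LinearIndependent ℝ b → (∀ (j : Fin k) (r : ι), ∃ z : ℤ, ∑ a : Fin k, α r a * b j a = 2 * Real.pi * z) → ∀ (g ζ : ℝ), g ≠ 0 → ∀ (H : LatticeSineGordon.Config d N k → ℝ), Measurable H → (∀ φ, |H φ| ≤ 1) → (∀ (φ : LatticeSineGordon.Config d N k) (n : Fin k → ℤ), H (fun p => φ p + ∑ j : Fin k, (n j : ℝ) * b j p.2) = H φ) → ∀ (ρ : (Fin k → ℝ) → ℝ), Measurable ρ → (∀ θ : Fin k → ℝ, 0 ≤ ρ θ) → (∀ θ : Fin k → ℝ, Summable (fun n : Fin k → ℤ => ρ (θ + fun c => ∑ j : Fin k, (n j : ℝ) * b j c)) ∧ ∑' n : Fin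 k → ℤ, ρ (θ + fun c => ∑ j : Fin k, (n j : ℝ) * b j c) = 1) → (∫ φ : LatticeSineGordon.Config d N k, {φ : LatticeSineGordon.Config d N k | ∃ t : Fin k → ℝ, (∀ j : Fin k, 0 ≤ t j ∧ t j < 1) ∧ ∀ a : Fin k, (Fintype.card (TorusSite d N) : ℝ)⁻¹ * ∑ x : TorusSite d N, φ (x, a) = ∑ j : Fin k, t j * b j a}.indicator (fun φ => H φ * LatticeSineGordon.weight α g 0 ζ φ) φ) / (∫ φ : LatticeSineGordon.Config d N k, {φ : LatticeSineGordon.Config d N k | ∃ t : Fin k → ℝ, (∀ j : Fin k, 0 ≤ t j ∧ t j < 1) ∧ ∀ a : Fin k, (Fintype.card (TorusSite d N) : ℝ)⁻¹ * ∑ x : TorusSite d N, φ (x, a) = ∑ j : Fin k, t j * b j a}.indicator (fun φ => LatticeSineGordon.weight α g 0 ζ φ) φ) = (∫ φ : LatticeSineGordon.Config d N k, ρ (fun c => (Fintype.card (TorusSite d N) : ℝ)⁻¹ * ∑ x : TorusSite d N, φ (x, c)) * (H φ * LatticeSineGordon.weight α g 0 ζ φ)) / (∫ φ : LatticeSineGordon.Config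 d N k, ρ (fun c => (Fintype.card (TorusSite d N) : ℝ)⁻¹ * ∑ x : TorusSite d N, φ (x, c)) * LatticeSineGordon.weight α g 0 ζ φ) := by
  intro d N k _ ι _ α b hb hcomm g ζ hg H hHm hHb hHper ρ hρm hρ0 hρ1
  -- the lattice vectors are dual to the charges, so the `ε = 0` weight is shift invariant
  have hwdual : ∀ (n : Fin k → ℤ) (r : ι), ∃ z : ℤ, ∑ a, α r a * (∑ j : Fin k, (n j : ℝ) * b j a) = 2 * Real.pi * z := by
    intro n r
    choose z hz using fun j => hcomm j r
    refine ⟨∑ j, n j * z j, ?_⟩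
    calc ∑ a, α r a * (∑ j : Fin k, (n j : ℝ) * b j a) = ∑ j, (n j : ℝ) * ∑ a, α r a * b j a := by
          simp only [mul_sum]
          rw [sum_comm]
          exact sum_congr rfl fun j _ => sum_congr rfl fun a _ => by ring
      _ = ∑ j, (n j : ℝ) * (2 * Real.pi * z j) := sum_congr rfl fun j _ => by rw [hz j]
      _ = 2 * Real.pi * ((∑ j, n j * z j : ℤ) : ℝ) := by
          push_cast
          rw [mul_sum]
          exact sum_congr rfl fun j _ => by ring
  have hWper : ∀ (φ : LatticeSineGordon.Config d N k) (n : Fin k → ℤ),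
      LatticeSineGordon.weight α g 0 ζ (fun p => φ p + ∑ j : Fin k, (n j : ℝ) * b j p.2) = LatticeSineGordon.weight α g 0 ζ φ := by
    intro φ n
    rw [weight_add_dual d N k ι α g 0 ζ (fun a => ∑ j : Fin k, (n j : ℝ) * b j a) (hwdual n) φ]
    simp
  have hHWper : ∀ (φ : LatticeSineGordon.Config d N k) (n : Fin k → ℤ),
      H (fun p => φ p + ∑ j : Fin k, (n j : ℝ) * b j p.2) * LatticeSineGordon.weight α g 0 ζ (fun p => φ p + ∑ j : Fin k, (n j : ℝ) * b j p.2) =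
        H φ * LatticeSineGordon.weight α g 0 ζ φ := fun φ n => by rw [hHper, hWper]
  -- integrability on the cell
  have hIW := integrable_indicator_weight_zero d N k ι α b hb g ζ hg
  have hWm : Measurable fun φ : LatticeSineGordon.Config d N k => LatticeSineGordon.weight α g 0 ζ φ :=
    (LatticeSineGordon.continuous_weight α g 0 ζ).measurable
  have hIHW : Integrable ({φ : LatticeSineGordon.Config d N k | ∃ t : Fin k → ℝ, (∀ j : Fin k, 0 ≤ t j ∧ t j < 1) ∧ ∀ a : Fin k, (Fintype.card (TorusSite d N) : ℝ)⁻¹ * ∑ x : TorusSite d N, φ (x, a) = ∑ j : Fin k, t j * b j a}.indicator (fun φ => H φ * LatticeSineGordon.weight α g 0 ζ φ)) := by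
    refine hIW.mono' ((hHm.mul hWm).indicator ?_).aestronglyMeasurable (Filter.Eventually.of_forall fun φ => ?_)
    · exact measurableSet_zeroModeCell d N k b hb
    · rw [Real.norm_eq_abs]
      by_cases hφ : φ ∈ {φ : LatticeSineGordon.Config d N k | ∃ t : Fin k → ℝ, (∀ j : Fin k, 0 ≤ t j ∧ t j < 1) ∧ ∀ a : Fin k, (Fintype.card (TorusSite d N) : ℝ)⁻¹ * ∑ x : TorusSite d N, φ (x, a) = ∑ j : Fin k, t j * b j a}
      · rw [Set.indicator_of_mem hφ, Set.indicator_of_mem hφ, abs_mul,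
          abs_of_pos (LatticeSineGordon.weight_pos α g 0 ζ φ)]
        have := hHb φ
        have hw := LatticeSineGordon.weight_pos α g 0 ζ φ
        nlinarith
      · rw [Set.indicator_of_notMem hφ, Set.indicator_of_notMem hφ, abs_zero]
  rw [integral_zeroMode_partition d N k b hb (fun φ => H φ * LatticeSineGordon.weight α g 0 ζ φ) (hHm.mul hWm)
      hHWper hIHW ρ hρm hρ0 hρ1,
    integral_zeroMode_partition d N k b hb (fun φ => LatticeSineGordon.weight α g 0 ζ φ) hWm hWper hIW ρ hρm hρ0 hρ1]

end Summit.QuantumFields.YangMills.Theorems.AnchorGap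

end
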